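import Literature.AnabelianGeometry.EtaleTheta.SettingModel2Theta
import Literature.AnabelianGeometry.EtaleTheta.SettingModelHeisenbergPresentation
import HarnessLib

/-!
# A model of the [EtTh] §1 root — the theta-quotient kernels of `F̂₂` ARE the joint kernels of the level maps

Mochizuki, *The étale theta function …*, Publ. RIMS **45** (2009) [EtTh], §1, PRIMS PDF p. 12
[cite: MochizukiEtTh2009, §1 p.12]: "`Δ^Θ_X := Δ_X/[Δ_X,[Δ_X,Δ_X]]`", "`Δ^ell_X := Δ^ab_X = Δ_X/[Δ_X,Δ_X]`",
"`Δ_Θ` (`≅ Ẑ(1)`)". Layer L2 of the abc-iut cell (seat abc-iut-L6-d6 gen 4; abc-iut-L2-lead gen 3 RULINGS #13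
R100, file F1b of the R78 «χ-twisted root model» cluster). PROOF-ONLY and MODEL-INDEPENDENT: everything
here is about the profinite free group `F̂₂ = F₂hatT` of abc-iut-L2-t1's `SettingModelFreeGroup.lean` and its
continuous LEVEL MAPS `ĥ_N : F̂₂ → Heis (ℤ/N)` (`hHat N`, `SettingModel2Theta.lean`), so it serves the finer
model `model₂` and the twisted model alike.

abc-iut-L2-t1 proved ONE direction: the level maps kill the closure `[[F̂₂,F̂₂],F̂₂]⁻`
(`hHat_eq_one_of_mem_closure`). With the discrete presentation `Ker(F₂ ↠ Heis ℤ) = [[F₂,F₂],F₂]`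
(`ker_heisHom_eq_commutator_commutator`, `SettingModelHeisenbergPresentation.lean`) and the density of
`η(F₂)` in `F̂₂` this file proves the converse:

* `mem_topologicalClosure_of_forall_mem_sup` — in a profinite group, `x ∈ ⋂_V (S·V)` over the open normal
  subgroups `V` forces `x ∈ S⁻`;
* **`mem_closure_commutator₃_iff_forall_hHat`** — `x ∈ [[F̂₂,F̂₂],F̂₂]⁻ ↔ ∀ N, ĥ_N(x) = 1`: the profinite
  theta-quotient kernel is the joint kernel of the finite Heisenberg quotients, i.e.
  `F̂₂/[[F̂₂,F̂₂],F̂₂]⁻ ↪ lim_N Heis(ℤ/N) = Heis(Ẑ)`;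
* **`mem_closure_commutator₂_iff_forall_hHat`** — `x ∈ [F̂₂,F̂₂]⁻ ↔ ∀ N, ĥ_N(x)` has `x = y = 0`;
* `hHat_eta_commutator_zpow`, `eta_commutator_zpow_mem_closure` — the powers of the basic commutator
  `c = ⁅a,b⁆` realise every integer `z`-coordinate inside `[F̂₂,F̂₂]⁻`.
The consequences for abc-iut-L2-t1's kernels `KTheta₂ ⊆ KEll₂` over `curve₂` (coordinates, and the
`z`-coordinate law coordinatising `Δ_Θ`) are in the sequel `SettingModel2LevelKernels.lean`.

Classical profinite group theory ([RibesZalesskii2010, §3.2] closures in profinite groups; [folklore] class-two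
presentation); nothing of [EtTh] is asserted; a model is consistency evidence only; no side is taken on
[IUTchIII] Cor. 3.12. No definitions, no instances, no Prop facts.
-/

noncomputable section

namespace Literature.AnabelianGeometry.EtaleTheta.SettingModel

open Literature.AnabelianGeometry.SemiGraphs
open CategoryTheory Function
open scoped commutatorElement Pointwise

/-! ### Closures in profinite groups via open normal subgroups -/

/-- In a profinite group, an element lying in `S·V` for EVERY open normal subgroup `V` lies in the closure
of the subgroup `S`. [cite: RibesZalesskii2010, §3.2] -/
theorem mem_topologicalClosure_of_forall_mem_sup {G : Type*} [Group G] [TopologicalSpace G]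
    [IsTopologicalGroup G] [CompactSpace G] [TotallyDisconnectedSpace G] (S : Subgroup G) (x : G)
    (h : ∀ V : OpenNormalSubgroup G, x ∈ S ⊔ V.toSubgroup) : x ∈ S.topologicalClosure := by
  show x ∈ (S.topologicalClosure : Set G)
  rw [Subgroup.topologicalClosure_coe, mem_closure_iff]
  intro U hU hxU
  have hpre : IsOpen ((fun w : G => x * w) ⁻¹' U) := hU.preimage (continuous_const_mul x)
  obtain ⟨V, hV⟩ := ProfiniteGrp.exist_openNormalSubgroup_sub_open_nhds_of_one hpre
    (show (1 : G) ∈ (fun w : G => x * w) ⁻¹' U by simpa using hxU)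
  have hx : x ∈ ((S ⊔ V.toSubgroup : Subgroup G) : Set G) := h V
  rw [Subgroup.mul_normal] at hx
  obtain ⟨s, hs, v, hv, hsv⟩ := hx
  refine ⟨s, ?_, hs⟩
  have hv' : v⁻¹ ∈ (V : Set G) := V.toSubgroup.inv_mem hv
  have h2 := hV hv'
  simp only [Set.mem_preimage] at h2
  rwa [← hsv, mul_assoc, mul_inv_cancel, mul_one] at h2

/-- Density of `η(F₂)`: every element of `F̂₂` is `η(g)·w⁻¹` with `w` in any given open neighbourhood-subset
of `1`. [cite: MochizukiEtTh2009, §1 p.12] -/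
private theorem exists_eta_eq_mul (x : F₂hatT) (W : Set F₂hatT) (hW : IsOpen W) (h1 : (1 : F₂hatT) ∈ W) :
    ∃ (g : F₂) (w : F₂hatT), w ∈ W ∧ eta g = x * w := by
  have hopen : IsOpen ((fun w : F₂hatT => x * w) '' W) := (Homeomorph.mulLeft x).isOpenMap W hW
  have hne : ((fun w : F₂hatT => x * w) '' W).Nonempty := ⟨x * 1, 1, h1, rfl⟩
  obtain ⟨g, w, hw, hgw⟩ := denseRange_eta.exists_mem_open hopen hne
  exact ⟨g, w, hw, hgw.symm⟩

/-! ### The algebraic step: homomorphisms `F₂ → Q'` into finite class-two quotients -/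

/-- The quotient of a group by `[[G,G],G]` has `[[·,·],·] = 1`. [folklore] -/
private theorem commutator₃_quotient_eq_bot {H : Type*} [Group H] (N : Subgroup H) [N.Normal]
    (hN : ⁅⁅(⊤ : Subgroup H), (⊤ : Subgroup H)⁆, (⊤ : Subgroup H)⁆ ≤ N) :
    ⁅⁅(⊤ : Subgroup (H ⧸ N)), (⊤ : Subgroup (H ⧸ N))⁆, (⊤ : Subgroup (H ⧸ N))⁆ = ⊥ := by
  have htop : (⊤ : Subgroup (H ⧸ N)) = (⊤ : Subgroup H).map (QuotientGroup.mk' N) :=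
    (Subgroup.map_top_of_surjective _ (QuotientGroup.mk'_surjective N)).symm
  rw [htop, ← Subgroup.map_commutator, ← Subgroup.map_commutator, eq_bot_iff]
  rintro _ ⟨x, hx, rfl⟩
  rw [Subgroup.mem_bot, QuotientGroup.mk'_apply, QuotientGroup.eq_one_iff]
  exact hN hx

/-- A homomorphism `φ : F₂ → Q'` into a group with `[[Q',Q'],Q'] = 1` factors through `heisHom`
(`Ker heisHom = [[F₂,F₂],F₂]`). [cite: MochizukiEtTh2009, §1 p.12] -/
private theorem exists_factor_heisHom {Q' : Type*} [Group Q'] (φ : F₂ →* Q')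
    (hQ : ⁅⁅(⊤ : Subgroup Q'), (⊤ : Subgroup Q')⁆, (⊤ : Subgroup Q')⁆ = ⊥) :
    ∃ f : Heis ℤ →* Q', ∀ g : F₂, f (heisHom g) = φ g := by
  set N : Subgroup F₂ := ⁅⁅(⊤ : Subgroup F₂), (⊤ : Subgroup F₂)⁆, (⊤ : Subgroup F₂)⁆ with hN
  haveI : N.Normal := by rw [hN]; infer_instance
  have hker : N ≤ φ.ker := by
    rw [hN, ← Subgroup.map_eq_bot_iff, Subgroup.map_commutator, Subgroup.map_commutator, eq_bot_iff, ← hQ]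
    exact Subgroup.commutator_mono (Subgroup.commutator_mono le_top le_top) le_top
  set e : F₂ ⧸ N ≃* Heis ℤ := MulEquiv.ofBijective _ bijective_lift_heisHom with hedef
  refine ⟨(QuotientGroup.lift N φ hker).comp e.symm.toMonoidHom, fun g => ?_⟩
  have he : e (QuotientGroup.mk g : F₂ ⧸ N) = heisHom g := by
    rw [hedef, MulEquiv.ofBijective_apply]
    exact QuotientGroup.lift_mk _ _ g
  rw [MonoidHom.comp_apply, MulEquiv.coe_toMonoidHom, ← he, MulEquiv.symm_apply_apply]
  exact QuotientGroup.lift_mk _ _ g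

/-- In a finite group of cardinality `M`, `g ^ k = 1` whenever `M ∣ k`. [folklore] -/
private theorem zpow_eq_one_of_card_dvd {Q' : Type*} [Group Q'] [Finite Q'] (g : Q') {k : ℤ}
    (hk : ((Nat.card Q' : ℕ) : ℤ) ∣ k) : g ^ k = 1 := by
  obtain ⟨m, rfl⟩ := hk
  rw [zpow_mul, zpow_natCast, pow_card_eq_one', one_zpow]

/-- **The algebraic step.** For a homomorphism `φ : F₂ → Q'` into a FINITE group with `[[Q',Q'],Q'] = 1`
of cardinality `M`: if `heisHom g ≡ 1 (mod M)` coordinatewise then `φ g = 1` (decompose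
`(x,y,z) = (1,0,0)^x (0,1,0)^y (0,0,1)^(z−xy)` in `Heis ℤ`). [cite: MochizukiEtTh2009, §1 p.12] -/
private theorem map_eq_one_of_dvd_heisHom₃ {Q' : Type*} [Group Q'] [Finite Q'] (φ : F₂ →* Q')
    (hQ : ⁅⁅(⊤ : Subgroup Q'), (⊤ : Subgroup Q')⁆, (⊤ : Subgroup Q')⁆ = ⊥) (g : F₂)
    (hx : ((Nat.card Q' : ℕ) : ℤ) ∣ (heisHom g).x) (hy : ((Nat.card Q' : ℕ) : ℤ) ∣ (heisHom g).y)
    (hz : ((Nat.card Q' : ℕ) : ℤ) ∣ (heisHom g).z) : φ g = 1 := by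
  obtain ⟨f, hf⟩ := exists_factor_heisHom φ hQ
  rw [← hf]
  set h : Heis ℤ := heisHom g with hh
  have hdec : h = (⟨1, 0, 0⟩ : Heis ℤ) ^ h.x * (⟨0, 1, 0⟩ : Heis ℤ) ^ h.y *
      (⟨0, 0, 1⟩ : Heis ℤ) ^ (h.z - h.x * h.y) := by
    rw [Heis.zpow_eq_of_mul_eq_zero _ (by simp), Heis.zpow_eq_of_mul_eq_zero _ (by simp),
      Heis.zpow_eq_of_mul_eq_zero _ (by simp)]
    ext <;> simp
  rw [hdec, map_mul, map_mul, map_zpow, map_zpow, map_zpow, zpow_eq_one_of_card_dvd _ hx,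
    zpow_eq_one_of_card_dvd _ hy, zpow_eq_one_of_card_dvd _ (dvd_sub hz (dvd_mul_of_dvd_left hx _)),
    one_mul, one_mul]

/-- The abelian variant: for `φ : F₂ → Q'` into a FINITE group with `[Q',Q'] = 1` of cardinality `M`, if the
`x`- and `y`-coordinates of `heisHom g` are `≡ 0 (mod M)` then `φ g = 1`. [cite: MochizukiEtTh2009, §1 p.12] -/
private theorem map_eq_one_of_dvd_heisHom₂ {Q' : Type*} [Group Q'] [Finite Q'] (φ : F₂ →* Q')
    (hQ : ⁅(⊤ : Subgroup Q'), (⊤ : Subgroup Q')⁆ = ⊥) (g : F₂)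
    (hx : ((Nat.card Q' : ℕ) : ℤ) ∣ (heisHom g).x) (hy : ((Nat.card Q' : ℕ) : ℤ) ∣ (heisHom g).y) :
    φ g = 1 := by
  have hQ3 : ⁅⁅(⊤ : Subgroup Q'), (⊤ : Subgroup Q')⁆, (⊤ : Subgroup Q')⁆ = ⊥ := by
    rw [hQ, Subgroup.commutator_bot_left]
  obtain ⟨f, hf⟩ := exists_factor_heisHom φ hQ3
  rw [← hf]
  set h : Heis ℤ := heisHom g with hh
  have hdec : h = (⟨1, 0, 0⟩ : Heis ℤ) ^ h.x * (⟨0, 1, 0⟩ : Heis ℤ) ^ h.y *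
      (⟨0, 0, 1⟩ : Heis ℤ) ^ (h.z - h.x * h.y) := by
    rw [Heis.zpow_eq_of_mul_eq_zero _ (by simp), Heis.zpow_eq_of_mul_eq_zero _ (by simp),
      Heis.zpow_eq_of_mul_eq_zero _ (by simp)]
    ext <;> simp
  have hc : f ⟨0, 0, 1⟩ = 1 := by
    have h1 : (⟨0, 0, 1⟩ : Heis ℤ) = ⁅(⟨1, 0, 0⟩ : Heis ℤ), ⟨0, 1, 0⟩⁆ := by
      rw [Heis.commutatorElement_eq]; norm_num
    rw [h1, map_commutatorElement, ← Subgroup.mem_bot, ← hQ]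
    exact Subgroup.commutator_mem_commutator (Subgroup.mem_top _) (Subgroup.mem_top _)
  rw [hdec, map_mul, map_mul, map_zpow, map_zpow, map_zpow, zpow_eq_one_of_card_dvd _ hx,
    zpow_eq_one_of_card_dvd _ hy, hc, one_zpow, one_mul, one_mul]

/-! ### The topological step -/

/-- For an open normal subgroup `V` of `F̂₂`, the composite `F₂ → F̂₂ → F̂₂/V → (F̂₂/V)/T`. [folklore] -/
private theorem mem_sup_of_map_eta_eq_one (S : Subgroup F₂hatT) (V : OpenNormalSubgroup F₂hatT)
    [hSn : (S.map (QuotientGroup.mk' V.toSubgroup)).Normal]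
    {x w : F₂hatT} {g : F₂} (hw : w ∈ V.toSubgroup) (hgx : eta g = x * w)
    (hg : QuotientGroup.mk' (S.map (QuotientGroup.mk' V.toSubgroup))
      (QuotientGroup.mk' V.toSubgroup (eta g)) = 1) :
    x ∈ S ⊔ V.toSubgroup := by
  rw [QuotientGroup.mk'_apply, QuotientGroup.eq_one_iff, ← Subgroup.mem_comap, Subgroup.comap_map_eq,
    QuotientGroup.ker_mk'] at hg
  have hx : x = eta g * w⁻¹ := by rw [hgx, mul_inv_cancel_right]
  rw [hx]
  exact (S ⊔ V.toSubgroup).mul_mem hg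
    ((S ⊔ V.toSubgroup).inv_mem (Subgroup.mem_sup_right hw))

/-- **`[[F̂₂,F̂₂],F̂₂]⁻` is the joint kernel of the level maps `ĥ_N : F̂₂ → Heis (ℤ/N)`** — equivalently
`F̂₂/[[F̂₂,F̂₂],F̂₂]⁻` embeds in `lim_N Heis(ℤ/N) = Heis(Ẑ)`; the profinite form of
"`Δ^Θ_X := Δ_X/[Δ_X,[Δ_X,Δ_X]]`" (p. 12) at the model. (⇒ is abc-iut-L2-t1's `hHat_eq_one_of_mem_closure`.)
[cite: MochizukiEtTh2009, §1 p.12] -/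
theorem mem_closure_commutator₃_iff_forall_hHat (x : F₂hatT) :
    x ∈ (⁅⁅(⊤ : Subgroup F₂hatT), (⊤ : Subgroup F₂hatT)⁆, (⊤ : Subgroup F₂hatT)⁆).topologicalClosure ↔
      ∀ N : ℕ+, hHat N x = 1 := by
  refine ⟨fun hx N => hHat_eq_one_of_mem_closure N hx, fun h => ?_⟩
  set S : Subgroup F₂hatT := ⁅⁅(⊤ : Subgroup F₂hatT), (⊤ : Subgroup F₂hatT)⁆, (⊤ : Subgroup F₂hatT)⁆
    with hS
  apply mem_topologicalClosure_of_forall_mem_sup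
  intro V
  -- the finite class-two quotient `Q' := (F̂₂/V)/[[·,·],·]`
  set π : F₂hatT →* F₂hatT ⧸ V.toSubgroup := QuotientGroup.mk' V.toSubgroup with hπ
  have hπs : Surjective π := QuotientGroup.mk'_surjective _
  set T : Subgroup (F₂hatT ⧸ V.toSubgroup) := S.map π with hT
  have hT' : T = ⁅⁅(⊤ : Subgroup (F₂hatT ⧸ V.toSubgroup)), (⊤ : Subgroup (F₂hatT ⧸ V.toSubgroup))⁆,
      (⊤ : Subgroup (F₂hatT ⧸ V.toSubgroup))⁆ := by
    rw [hT, hS, Subgroup.map_commutator, Subgroup.map_commutator, Subgroup.map_top_of_surjective _ hπs]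
  haveI hTn : T.Normal := by rw [hT']; infer_instance
  haveI : Finite (F₂hatT ⧸ V.toSubgroup) := Subgroup.quotient_finite_of_isOpen _ V.isOpen
  haveI : Finite ((F₂hatT ⧸ V.toSubgroup) ⧸ T) := Quotient.finite _
  have hQ : ⁅⁅(⊤ : Subgroup ((F₂hatT ⧸ V.toSubgroup) ⧸ T)), (⊤ : Subgroup ((F₂hatT ⧸ V.toSubgroup) ⧸ T))⁆,
      (⊤ : Subgroup ((F₂hatT ⧸ V.toSubgroup) ⧸ T))⁆ = ⊥ :=
    commutator₃_quotient_eq_bot T (by rw [hT'])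
  -- the level `M := |Q'|`
  set M : ℕ+ := ⟨Nat.card ((F₂hatT ⧸ V.toSubgroup) ⧸ T), Nat.card_pos⟩ with hM
  -- approximate `x` by `η(g)` inside `x · (V ∩ Ker ĥ_M)`
  have hWopen : IsOpen ((V : Set F₂hatT) ∩ (hHat M) ⁻¹' {1}) :=
    V.isOpen.inter ((isOpen_discrete _).preimage (hHat M).continuous)
  obtain ⟨g, w, ⟨hwV, hwK⟩, hgx⟩ := exists_eta_eq_mul x _ hWopen ⟨V.toSubgroup.one_mem, by simp⟩
  have hgM : hHat M (eta g) = 1 := by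
    rw [hgx, map_mul, h M, one_mul]; exact hwK
  rw [hHat_eta, Heis.ext_iff] at hgM
  simp only [Heis.map_apply, Heis.one_x, Heis.one_y, Heis.one_z, Int.coe_castRingHom,
    ZMod.intCast_zmod_eq_zero_iff_dvd] at hgM
  obtain ⟨hgx', hgy', hgz'⟩ := hgM
  -- the algebraic step kills `g` in `Q'`
  have hφ := map_eq_one_of_dvd_heisHom₃ (((QuotientGroup.mk' T).comp π).comp eta) hQ g hgx' hgy' hgz'
  exact mem_sup_of_map_eta_eq_one S V hwV hgx hφ

/-- `[F̂₂,F̂₂]⁻` lies in the joint kernel of the `x`,`y`-coordinates of the level maps. [cite: MochizukiEtTh2009, §1 p.12] -/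
private theorem hHat_xy_eq_zero_of_mem_closure (N : ℕ+) {x : F₂hatT}
    (hx : x ∈ (⁅(⊤ : Subgroup F₂hatT), (⊤ : Subgroup F₂hatT)⁆).topologicalClosure) :
    (hHat N x).x = 0 ∧ (hHat N x).y = 0 := by
  have hker : (⁅(⊤ : Subgroup F₂hatT), (⊤ : Subgroup F₂hatT)⁆).topologicalClosure ≤
      (Heis.zAxis : Subgroup (Heis (ZMod N))).comap (hHat N).toMonoidHom := by
    refine Subgroup.topologicalClosure_minimal _ ?_ ?_
    · rw [← Subgroup.map_le_iff_le_comap, Subgroup.map_commutator]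
      exact (Subgroup.commutator_mono le_top le_top).trans Heis.commutator_top_le_zAxis
    · change IsClosed ((fun x : F₂hatT => hHat N x) ⁻¹'
        (((Heis.zAxis : Subgroup (Heis (ZMod N))) : Set (Heis (ZMod N)))))
      exact (isClosed_discrete _).preimage (hHat N).continuous
  exact hker hx

/-- **`[F̂₂,F̂₂]⁻` is the joint kernel of the `x`,`y`-coordinates of the level maps** — the profinite form of
"`Δ^ell_X := Δ^ab_X = Δ_X/[Δ_X,Δ_X]`" (p. 12): `F̂₂/[F̂₂,F̂₂]⁻ ↪ lim_N (ℤ/N)² = Ẑ²`.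
[cite: MochizukiEtTh2009, §1 p.12] -/
theorem mem_closure_commutator₂_iff_forall_hHat (x : F₂hatT) :
    x ∈ (⁅(⊤ : Subgroup F₂hatT), (⊤ : Subgroup F₂hatT)⁆).topologicalClosure ↔
      ∀ N : ℕ+, (hHat N x).x = 0 ∧ (hHat N x).y = 0 := by
  refine ⟨fun hx N => hHat_xy_eq_zero_of_mem_closure N hx, fun h => ?_⟩
  set S : Subgroup F₂hatT := ⁅(⊤ : Subgroup F₂hatT), (⊤ : Subgroup F₂hatT)⁆ with hS
  apply mem_topologicalClosure_of_forall_mem_sup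
  intro V
  set π : F₂hatT →* F₂hatT ⧸ V.toSubgroup := QuotientGroup.mk' V.toSubgroup with hπ
  have hπs : Surjective π := QuotientGroup.mk'_surjective _
  set T : Subgroup (F₂hatT ⧸ V.toSubgroup) := S.map π with hT
  have hT' : T = ⁅(⊤ : Subgroup (F₂hatT ⧸ V.toSubgroup)), (⊤ : Subgroup (F₂hatT ⧸ V.toSubgroup))⁆ := by
    rw [hT, hS, Subgroup.map_commutator, Subgroup.map_top_of_surjective _ hπs]
  haveI hTn : T.Normal := by rw [hT']; infer_instance
  haveI : Finite (F₂hatT ⧸ V.toSubgroup) := Subgroup.quotient_finite_of_isOpen _ V.isOpen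
  haveI : Finite ((F₂hatT ⧸ V.toSubgroup) ⧸ T) := Quotient.finite _
  have hQ : ⁅(⊤ : Subgroup ((F₂hatT ⧸ V.toSubgroup) ⧸ T)), (⊤ : Subgroup ((F₂hatT ⧸ V.toSubgroup) ⧸ T))⁆ = ⊥ := by
    have htop : (⊤ : Subgroup ((F₂hatT ⧸ V.toSubgroup) ⧸ T)) =
        (⊤ : Subgroup (F₂hatT ⧸ V.toSubgroup)).map (QuotientGroup.mk' T) :=
      (Subgroup.map_top_of_surjective _ (QuotientGroup.mk'_surjective T)).symm
    rw [htop, ← Subgroup.map_commutator, eq_bot_iff]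
    rintro _ ⟨y, hy, rfl⟩
    rw [Subgroup.mem_bot, QuotientGroup.mk'_apply, QuotientGroup.eq_one_iff, hT']
    exact hy
  set M : ℕ+ := ⟨Nat.card ((F₂hatT ⧸ V.toSubgroup) ⧸ T), Nat.card_pos⟩ with hM
  -- approximate `x` by `η(g)` inside `x · (V ∩ Ker ĥ_M)`, so that `ĥ_M(η g) = ĥ_M(x)`
  have hWopen' : IsOpen ((V : Set F₂hatT) ∩ (hHat M) ⁻¹' {1}) :=
    V.isOpen.inter ((isOpen_discrete _).preimage (hHat M).continuous)
  obtain ⟨g, w, ⟨hwV, hwK⟩, hgx⟩ := exists_eta_eq_mul x _ hWopen' ⟨V.toSubgroup.one_mem, by simp⟩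
  have hgM : hHat M (eta g) = hHat M x := by
    rw [hgx, map_mul]
    have : hHat M w = 1 := hwK
    rw [this, mul_one]
  obtain ⟨hx0, hy0⟩ := h M
  have hgx' : ((M : ℕ) : ℤ) ∣ (heisHom g).x := by
    have := congrArg Heis.x hgM
    rw [hx0, hHat_eta] at this
    simpa [ZMod.intCast_zmod_eq_zero_iff_dvd] using this
  have hgy' : ((M : ℕ) : ℤ) ∣ (heisHom g).y := by
    have := congrArg Heis.y hgM
    rw [hy0, hHat_eta] at this
    simpa [ZMod.intCast_zmod_eq_zero_iff_dvd] using this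
  have hφ := map_eq_one_of_dvd_heisHom₂ (((QuotientGroup.mk' T).comp π).comp eta) hQ g hgx' hgy'
  exact mem_sup_of_map_eta_eq_one S V hwV hgx hφ

/-- The level maps on the powers of the basic commutator `c = ⁅a,b⁆ ∈ F₂`: `ĥ_N(η(c^k)) = (0,0,k mod N)` —
so every compatible family of `z`-coordinates in `ℤ ⊆ Ẑ` is realised inside `[F̂₂,F̂₂]⁻` (with
`inv_mul_mem_KTheta₂_iff_forall_hHat_z_eq`: the image of `Δ_Θ ↪ Ẑ` contains `ℤ`). [cite: MochizukiEtTh2009, §1 p.12] -/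
theorem hHat_eta_commutator_zpow (N : ℕ+) (k : ℤ) :
    hHat N (eta (⁅FreeGroup.of (0 : Fin 2), FreeGroup.of 1⁆ ^ k)) = ⟨0, 0, (k : ZMod N)⟩ := by
  rw [hHat_eta, map_zpow, heisHom_commutator, Heis.zpow_eq_of_mul_eq_zero _ (by simp)]
  ext <;> simp

/-- `η(c^k)` lies in `[F̂₂,F̂₂]⁻` (indeed in `[F̂₂,F̂₂]`). [cite: MochizukiEtTh2009, §1 p.12] -/
theorem eta_commutator_zpow_mem_closure (k : ℤ) :
    eta (⁅FreeGroup.of (0 : Fin 2), FreeGroup.of 1⁆ ^ k) ∈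
      (⁅(⊤ : Subgroup F₂hatT), (⊤ : Subgroup F₂hatT)⁆).topologicalClosure := by
  refine Subgroup.le_topologicalClosure _ ?_
  rw [map_zpow]
  refine Subgroup.zpow_mem _ ?_ k
  rw [map_commutatorElement]
  exact Subgroup.commutator_mem_commutator (Subgroup.mem_top _) (Subgroup.mem_top _)

end Literature.AnabelianGeometry.EtaleTheta.SettingModel

end
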